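import Literature.Analysis.FluidPDE.WeakGradientTransportIdentity
import Literature.Analysis.FluidPDE.WeakSpatialGradientSum
import Literature.Analysis.FluidPDE.ClassicalSuitable
import Literature.Analysis.FluidPDE.MollifiedLerayDistributional
import Mathlib.Analysis.Calculus.BumpFunction.FiniteDimension
import HarnessLib

/-!
# [BT1] weak formulation on the line, II: the polarised transport identity (drift and dilation
  terms moved onto the test field)

Analysis/FluidPDE proof file (theorems only; no definitions, no named facts) in the DAG below the
named fact `Literature.Analysis.FluidPDE.bradshawTsai2017_thm_2_4_mollified`.

## References

* Z. Bradshaw, T.-P. Tsai, Ann. Henri Poincaré 18 (2017) = arXiv:1510.07504, §2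
  [BradshawTsai2017AHP].
* L. C. Evans, *Partial Differential Equations* (2010), §5.2.3 Thm. 1 (iv). [Evans2010]
-/

noncomputable section

open MeasureTheory Set Function Filter Topology TopologicalSpace Metric ContinuousLinearMap
open scoped NNReal ENNReal InnerProductSpace RealInnerProductSpace ContDiff

namespace Literature.Analysis.FluidPDE

/-! ### Polarising the transport identity: the drift and dilation terms moved onto the test field -/

section Polarization

variable {E : Type*} [NormedAddCommGroup E] [InnerProductSpace ℝ E] [FiniteDimensional ℝ E]
  [MeasurableSpace E] [BorelSpace E]

omit [MeasurableSpace E] [BorelSpace E] in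
/-- A smooth space–time cut-off equal to `1` on a neighbourhood of a compact set: for compact
`K ⊆ ℝ × E` there are a test function `θ` on `ℝ × E` and `R` with `K ⊆ B(0, R)`, `θ = 1` on
`B̄(0, R)`, hence `∇θ(t, ·) = 0` on `B(0, R)`. [folklore] -/
theorem exists_spaceTime_cutoff_eq_one {K : Set (ℝ × E)} (hK : IsCompact K) :
    ∃ (θ : ℝ → E → ℝ) (R : ℝ), IsSpaceTimeTestOn (⊤ : Opens (ℝ × E)) θ ∧ 0 < R ∧
      K ⊆ ball (0 : ℝ × E) R ∧ (∀ z ∈ closedBall (0 : ℝ × E) R, θ z.1 z.2 = 1) ∧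
      ∀ z ∈ ball (0 : ℝ × E) R, gradient (θ z.1) z.2 = 0 := by
  obtain ⟨R₀, hR₀⟩ := hK.isBounded.subset_closedBall (0 : ℝ × E)
  set R : ℝ := |R₀| + 1 with hR
  have hR0 : 0 < R := by positivity
  have hKR : K ⊆ ball (0 : ℝ × E) R := hR₀.trans (closedBall_subset_ball (by
    rw [hR]; linarith [le_abs_self R₀]))
  let f : ContDiffBump (0 : ℝ × E) := ⟨R, R + 1, hR0, by linarith⟩
  refine ⟨fun t x => f (t, x), R, ⟨?_, ?_, by simp⟩, hR0, hKR, fun z hz => ?_, fun z hz => ?_⟩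
  · exact f.contDiff
  · exact f.hasCompactSupport
  · exact f.one_of_mem_closedBall hz
  · -- on the open ball `f ≡ 1`, so all derivatives vanish
    have hev : (f : ℝ × E → ℝ) =ᶠ[𝓝 z] fun _ => (1 : ℝ) := by
      filter_upwards [isOpen_ball.mem_nhds hz] with z' hz'
      exact f.one_of_mem_closedBall (ball_subset_closedBall hz')
    have h0 : fderiv ℝ (f : ℝ × E → ℝ) z = 0 := by
      rw [hev.fderiv_eq, fderiv_fun_const, Pi.zero_apply]
    have hd : DifferentiableAt ℝ (f : ℝ × E → ℝ) (z.1, z.2) :=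
      ((f.contDiff (n := 1)).differentiable one_ne_zero) _
    rw [gradient]
    have : fderiv ℝ (fun y => f (z.1, y)) z.2 = 0 := by
      rw [fderiv_slice hd, show ((z.1, z.2) : ℝ × E) = z from rfl, h0, ContinuousLinearMap.zero_comp]
    rw [this, map_zero]

variable {U : ℝ → E → E} {G : ℝ → E → E →L[ℝ] E}

/-- `L²` on a compact set from local integrability of the square. [folklore] -/
theorem memLp_two_restrict_of_locallyIntegrable_sq {F' : Type*} [NormedAddCommGroup F']
    {f : ℝ × E → F'} (hfm : AEStronglyMeasurable f volume)
    (hf2 : LocallyIntegrable (fun z => ‖f z‖ ^ 2) volume) {K : Set (ℝ × E)} (hK : IsCompact K) :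
    MemLp f 2 (volume.restrict K) :=
  (memLp_two_iff_integrable_sq_norm hfm.restrict).2 (hf2.integrableOn_isCompact hK)

/-- A bounded a.e.-strongly measurable function on a set of finite measure is in `L²`.
[folklore] -/
theorem memLp_two_restrict_of_bound {F' : Type*} [NormedAddCommGroup F'] {f : ℝ × E → F'}
    {K : Set (ℝ × E)} (hK : IsCompact K) (hfm : AEStronglyMeasurable f (volume.restrict K))
    {C : ℝ} (hC : ∀ᵐ z ∂(volume.restrict K), ‖f z‖ ≤ C) : MemLp f 2 (volume.restrict K) := by
  haveI : IsFiniteMeasure (volume.restrict K) := isFiniteMeasure_restrict.2 hK.measure_lt_top.ne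
  exact (memLp_top_of_bound hfm C hC).mono_exponent le_top

set_option maxHeartbeats 800000 in
/-- **The polarised transport identity.** Let `U` have the weak spatial gradient `G` on `ℝ × E`
with `|U|², |G|² ∈ L¹_loc`, let `ψ` be a test field, and let `X` be a field as in
`HasWeakSpatialGradientOn.integral_inner_apply_field_eq` (supported in a compact set, `C¹` in
space for every time, jointly measurable with its divergence, both bounded). Then
`∫∫ ⟪G X, ψ⟫ + ∫∫ ⟪Dψ X, U⟫ = -∫∫ ⟪U, ψ⟫ div X` — the transport identity for `U + ψ` minus the
ones for `U` and `ψ`; i.e. the weak product rule `⟪(X·∇)U, ψ⟫ + ⟪(X·∇)ψ, U⟫ = X·∇⟪U, ψ⟫`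
integrated by parts. [cite: Evans2010, §5.2.3 Thm. 1 (iv)] -/
theorem HasWeakSpatialGradientOn.integral_inner_apply_field_polarized
    (hG : HasWeakSpatialGradientOn (⊤ : Opens (ℝ × E)) U G)
    (hu2 : LocallyIntegrable (fun z : ℝ × E => ‖U z.1 z.2‖ ^ 2) volume)
    (hG2 : LocallyIntegrable (fun z : ℝ × E => frobeniusNormSq (G z.1 z.2)) volume)
    {ψ : ℝ → E → E} (hψ : IsSpaceTimeTestOn (⊤ : Opens (ℝ × E)) ψ)
    {X : ℝ → E → E} {K : Set (ℝ × E)} (hK : IsCompact K)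
    (hXK : ∀ s y, (s, y) ∉ K → X s y = 0) (hX1 : ∀ s, ContDiff ℝ 1 (X s))
    (hXm : AEStronglyMeasurable (uncurry X) (volume : Measure (ℝ × E)))
    (hdm : AEStronglyMeasurable (fun z : ℝ × E => VectorCalculus.divergence (X z.1) z.2)
      (volume : Measure (ℝ × E)))
    {CX : ℝ} (hCX : ∀ᵐ z : ℝ × E, ‖X z.1 z.2‖ ≤ CX)
    {Cd : ℝ} (hCd : ∀ᵐ z : ℝ × E, |VectorCalculus.divergence (X z.1) z.2| ≤ Cd) :
    (∫ z : ℝ × E, ⟪G z.1 z.2 (X z.1 z.2), ψ z.1 z.2⟫) +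
      ∫ z : ℝ × E, ⟪fderiv ℝ (ψ z.1) z.2 (X z.1 z.2), U z.1 z.2⟫ =
      -∫ z : ℝ × E, ⟪U z.1 z.2, ψ z.1 z.2⟫ * VectorCalculus.divergence (X z.1) z.2 := by
  have hKQ : K ⊆ ((⊤ : Opens (ℝ × E)) : Set (ℝ × E)) := fun _ _ => trivial
  -- the classical gradient of the test field and the sum
  have hψ1 : ContDiff ℝ 1 (uncurry ψ) := hψ.contDiff.of_le (by exact_mod_cast le_top)
  have hψG : HasWeakSpatialGradientOn (⊤ : Opens (ℝ × E)) ψ fun t x => fderiv ℝ (ψ t) x :=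
    hasWeakSpatialGradientOn_of_contDiffOn isOpen_univ (fun _ _ => by simp)
      (by rw [univ_prod_univ]; exact hψ1.contDiffOn)
  have hsum := hG.add hψG
  -- continuity and bounds for `ψ`, `Dψ`
  have cψ : Continuous fun z : ℝ × E => ψ z.1 z.2 := hψ.contDiff.continuous
  have cDψ : Continuous fun z : ℝ × E => fderiv ℝ (ψ z.1) z.2 := hψ.fderiv_top.contDiff.continuous
  obtain ⟨Mψ, hMψ⟩ := cψ.bounded_above_of_compact_support hψ.hasCompactSupport
  obtain ⟨MD, hMD⟩ := cDψ.bounded_above_of_compact_support (hψ.fderiv_top).hasCompactSupport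
  -- local square integrability of the sum and of its gradient
  have hUm : AEStronglyMeasurable (uncurry U) volume := by
    have h := hG.locallyIntegrableOn.aestronglyMeasurable
    rwa [TopologicalSpace.Opens.coe_top, Measure.restrict_univ] at h
  have hGm : AEStronglyMeasurable (uncurry G) volume := by
    have h := hG.locallyIntegrableOn_grad.aestronglyMeasurable
    rwa [TopologicalSpace.Opens.coe_top, Measure.restrict_univ] at h
  have hu2' : LocallyIntegrable (fun z : ℝ × E => ‖U z.1 z.2 + ψ z.1 z.2‖ ^ 2) volume := by
    refine locallyIntegrable_iff.2 fun K' hK' => ?_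
    have h1 := hu2.integrableOn_isCompact hK'
    have hb : IntegrableOn (fun _ : ℝ × E => (2 : ℝ) * Mψ ^ 2) K' volume :=
      integrableOn_const (hs := hK'.measure_lt_top.ne)
    have hbd : IntegrableOn (fun z : ℝ × E => 2 * ‖U z.1 z.2‖ ^ 2 + 2 * Mψ ^ 2) K' volume :=
      (h1.const_mul 2).add hb
    refine Integrable.mono' hbd
      ((hUm.add cψ.aestronglyMeasurable).norm.pow 2).restrict (ae_of_all _ fun z => ?_)
    rw [Real.norm_eq_abs, abs_of_nonneg (by positivity)]
    have h := norm_add_le (U z.1 z.2) (ψ z.1 z.2)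
    have h2 := hMψ z
    show ‖U z.1 z.2 + ψ z.1 z.2‖ ^ 2 ≤ 2 * ‖U z.1 z.2‖ ^ 2 + 2 * Mψ ^ 2
    nlinarith [norm_nonneg (U z.1 z.2 + ψ z.1 z.2), norm_nonneg (U z.1 z.2),
      norm_nonneg (ψ z.1 z.2), sq_nonneg (‖U z.1 z.2‖ - ‖ψ z.1 z.2‖)]
  have hG2' : LocallyIntegrable (fun z : ℝ × E =>
      frobeniusNormSq (G z.1 z.2 + fderiv ℝ (ψ z.1) z.2)) volume := by
    refine locallyIntegrable_iff.2 fun K' hK' => ?_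
    have h1 := hG2.integrableOn_isCompact hK'
    obtain ⟨MF, hMF⟩ := hK'.exists_bound_of_continuousOn
      (f := fun z : ℝ × E => frobeniusNormSq (fderiv ℝ (ψ z.1) z.2))
      ((LerayHopfProofs.continuous_frobeniusNormSq.comp cDψ).continuousOn)
    have hb : IntegrableOn (fun _ : ℝ × E => (2 : ℝ) * MF) K' volume :=
      integrableOn_const (hs := hK'.measure_lt_top.ne)
    have hmeas : AEStronglyMeasurable (fun z : ℝ × E =>
        frobeniusNormSq (G z.1 z.2 + fderiv ℝ (ψ z.1) z.2)) (volume.restrict K') :=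
      LerayHopfProofs.continuous_frobeniusNormSq.comp_aestronglyMeasurable
        (hGm.restrict.add cDψ.aestronglyMeasurable.restrict)
    have hbd : IntegrableOn (fun z : ℝ × E => 2 * frobeniusNormSq (G z.1 z.2) + 2 * MF) K' volume :=
      (h1.const_mul 2).add hb
    refine Integrable.mono' hbd hmeas ?_
    filter_upwards [ae_restrict_mem hK'.measurableSet] with z hz
    rw [Real.norm_eq_abs, abs_of_nonneg (frobeniusNormSq_nonneg _)]
    have h := frobeniusNormSq_add_le (G z.1 z.2) (fderiv ℝ (ψ z.1) z.2)
    have h2 := hMF z hz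
    rw [Real.norm_eq_abs, abs_of_nonneg (frobeniusNormSq_nonneg _)] at h2
    linarith
  have hψ2 : LocallyIntegrable (fun z : ℝ × E => ‖ψ z.1 z.2‖ ^ 2) volume :=
    (cψ.norm.pow 2).locallyIntegrable
  have hDψ2 : LocallyIntegrable (fun z : ℝ × E => frobeniusNormSq (fderiv ℝ (ψ z.1) z.2)) volume :=
    (LerayHopfProofs.continuous_frobeniusNormSq.comp cDψ).locallyIntegrable
  -- ## the three transport identities
  have T1 := hsum.integral_inner_apply_field_eq (hu2'.locallyIntegrableOn _)
    (hG2'.locallyIntegrableOn _) hK hKQ hXK hX1 hXm hdm hCX hCd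
  have T2 := hG.integral_inner_apply_field_eq (hu2.locallyIntegrableOn _) (hG2.locallyIntegrableOn _)
    hK hKQ hXK hX1 hXm hdm hCX hCd
  have T3 := hψG.integral_inner_apply_field_eq (hψ2.locallyIntegrableOn _)
    (hDψ2.locallyIntegrableOn _) hK hKQ hXK hX1 hXm hdm hCX hCd
  simp only [TopologicalSpace.Opens.coe_top, Measure.restrict_univ] at T1 T2 T3
  -- ## integrability of the seven pieces (all supported in `K`)
  set μK : Measure (ℝ × E) := volume.restrict K with hμK
  have hX0 : ∀ z : ℝ × E, z ∉ K → X z.1 z.2 = 0 := fun z hz => hXK z.1 z.2 hz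
  have hUK : MemLp (uncurry U) 2 μK := memLp_two_restrict_of_locallyIntegrable_sq hUm
    (by simpa [uncurry] using hu2) hK
  have hGK2 : MemLp (uncurry G) 2 μK := by
    refine memLp_two_of_frobeniusNormSq hGm.restrict ?_
    have hi := hG2.integrableOn_isCompact hK
    refine lt_of_le_of_lt (lintegral_mono fun z => ?_) hi.2
    simp only [uncurry]
    rw [← Real.enorm_eq_ofReal (frobeniusNormSq_nonneg _)]
  have hGXK : MemLp (fun z : ℝ × E => G z.1 z.2 (X z.1 z.2)) 2 μK := by
    refine MemLp.of_le_mul (c := CX) hGK2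
      (isBoundedBilinearMap_apply.continuous.comp_aestronglyMeasurable
        (hGm.restrict.prodMk hXm.restrict)) ?_
    filter_upwards [ae_restrict_of_ae hCX] with z hz
    calc ‖G z.1 z.2 (X z.1 z.2)‖ ≤ ‖G z.1 z.2‖ * ‖X z.1 z.2‖ := le_opNorm _ _
      _ ≤ CX * ‖uncurry G z‖ := by
          rw [mul_comm]
          exact mul_le_mul_of_nonneg_right hz (norm_nonneg _)
  have hDψXK : MemLp (fun z : ℝ × E => fderiv ℝ (ψ z.1) z.2 (X z.1 z.2)) 2 μK := by
    refine memLp_two_restrict_of_bound hK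
      (isBoundedBilinearMap_apply.continuous.comp_aestronglyMeasurable
        (cDψ.aestronglyMeasurable.restrict.prodMk hXm.restrict)) (C := MD * CX) ?_
    filter_upwards [ae_restrict_of_ae hCX] with z hz
    calc ‖fderiv ℝ (ψ z.1) z.2 (X z.1 z.2)‖ ≤ ‖fderiv ℝ (ψ z.1) z.2‖ * ‖X z.1 z.2‖ := le_opNorm _ _
      _ ≤ MD * CX := mul_le_mul (hMD z) hz (norm_nonneg _) ((norm_nonneg _).trans (hMD z))
  have hψK : MemLp (fun z : ℝ × E => ψ z.1 z.2) 2 μK :=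
    memLp_two_restrict_of_bound hK cψ.aestronglyMeasurable.restrict (ae_of_all _ hMψ)
  -- from `L² × L²` pairings on `K` to integrability on `ℝ × E`
  have hext : ∀ {f : ℝ × E → ℝ}, (∀ z ∉ K, f z = 0) → Integrable f μK → Integrable f volume := by
    intro f hf0 hfi
    have hsupp : support f ⊆ K := fun z hz => by
      by_contra h
      exact hz (hf0 z h)
    exact (integrableOn_iff_integrable_of_support_subset hsupp).1 hfi
  have ia : Integrable (fun z : ℝ × E => ⟪G z.1 z.2 (X z.1 z.2), U z.1 z.2⟫) volume := by
    refine hext (fun z hz => by simp [hX0 z hz]) ?_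
    exact integrable_bilin_of_memLp (p := 2) (q := 2) (innerSL ℝ (E := E)) hGXK hUK
  have ib : Integrable (fun z : ℝ × E => ⟪G z.1 z.2 (X z.1 z.2), ψ z.1 z.2⟫) volume := by
    refine hext (fun z hz => by simp [hX0 z hz]) ?_
    exact integrable_bilin_of_memLp (p := 2) (q := 2) (innerSL ℝ (E := E)) hGXK hψK
  have ic : Integrable (fun z : ℝ × E => ⟪fderiv ℝ (ψ z.1) z.2 (X z.1 z.2), U z.1 z.2⟫) volume := by
    refine hext (fun z hz => by simp [hX0 z hz]) ?_
    exact integrable_bilin_of_memLp (p := 2) (q := 2) (innerSL ℝ (E := E)) hDψXK hUK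
  have id' : Integrable (fun z : ℝ × E => ⟪fderiv ℝ (ψ z.1) z.2 (X z.1 z.2), ψ z.1 z.2⟫) volume := by
    refine hext (fun z hz => by simp [hX0 z hz]) ?_
    exact integrable_bilin_of_memLp (p := 2) (q := 2) (innerSL ℝ (E := E)) hDψXK hψK
  -- the divergence vanishes off `K` a.e.? No: pointwise, `X s = 0` need not give `div = 0` at a
  -- boundary point; but `X s` is `C¹` and vanishes on the open complement... we use instead that
  -- the three weighted pieces are integrable on the whole space by the bound `|div X| ≤ Cd` and
  -- the compact support of `U`-independent factors only through `K ∪ tsupport ψ`.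
  have hdiv0 : ∀ z : ℝ × E, z ∉ K → VectorCalculus.divergence (X z.1) z.2 = 0 := by
    intro z hz
    -- `X z.1` vanishes on the open set `{y | (z.1, y) ∉ K}` containing `z.2`
    have ho : IsOpen {y : E | (z.1, y) ∉ K} :=
      (hK.isClosed.preimage (continuous_const.prodMk continuous_id)).isOpen_compl
    have hev : X z.1 =ᶠ[𝓝 z.2] fun _ => (0 : E) := by
      filter_upwards [ho.mem_nhds hz] with y hy
      exact hXK z.1 y hy
    rw [VectorCalculus.divergence, hev.fderiv_eq, fderiv_fun_const]
    simp
  have hCd' : ∀ᵐ z : ℝ × E, ‖VectorCalculus.divergence (X z.1) z.2‖ ≤ Cd := by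
    filter_upwards [hCd] with z hz
    rw [Real.norm_eq_abs]; exact hz
  have ie : Integrable (fun z : ℝ × E => ‖U z.1 z.2‖ ^ 2 * VectorCalculus.divergence (X z.1) z.2)
      volume := by
    refine hext (fun z hz => by simp [hdiv0 z hz]) ?_
    have h := integrable_mul_bilin_of_memLp (p := 2) (q := 2) (innerSL ℝ (E := E)) hUK hUK
      (C := Cd) hdm.restrict (ae_restrict_of_ae hCd')
    refine h.congr (ae_of_all _ fun z => ?_)
    show VectorCalculus.divergence (X z.1) z.2 * ⟪U z.1 z.2, U z.1 z.2⟫ =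
      ‖U z.1 z.2‖ ^ 2 * VectorCalculus.divergence (X z.1) z.2
    rw [real_inner_self_eq_norm_sq]; ring
  have if' : Integrable (fun z : ℝ × E => ⟪U z.1 z.2, ψ z.1 z.2⟫ * VectorCalculus.divergence (X z.1) z.2)
      volume := by
    refine hext (fun z hz => by simp [hdiv0 z hz]) ?_
    have h := integrable_mul_bilin_of_memLp (p := 2) (q := 2) (innerSL ℝ (E := E)) hUK hψK
      (C := Cd) hdm.restrict (ae_restrict_of_ae hCd')
    refine h.congr (ae_of_all _ fun z => ?_)
    show VectorCalculus.divergence (X z.1) z.2 * ⟪U z.1 z.2, ψ z.1 z.2⟫ =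
      ⟪U z.1 z.2, ψ z.1 z.2⟫ * VectorCalculus.divergence (X z.1) z.2
    ring
  have ig : Integrable (fun z : ℝ × E => ‖ψ z.1 z.2‖ ^ 2 * VectorCalculus.divergence (X z.1) z.2)
      volume := by
    refine hext (fun z hz => by simp [hdiv0 z hz]) ?_
    have h := integrable_mul_bilin_of_memLp (p := 2) (q := 2) (innerSL ℝ (E := E)) hψK hψK
      (C := Cd) hdm.restrict (ae_restrict_of_ae hCd')
    refine h.congr (ae_of_all _ fun z => ?_)
    show VectorCalculus.divergence (X z.1) z.2 * ⟪ψ z.1 z.2, ψ z.1 z.2⟫ =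
      ‖ψ z.1 z.2‖ ^ 2 * VectorCalculus.divergence (X z.1) z.2
    rw [real_inner_self_eq_norm_sq]; ring
  -- ## expand `T1`
  have eL : ∫ z : ℝ × E, ⟪(G z.1 z.2 + fderiv ℝ (ψ z.1) z.2) (X z.1 z.2), U z.1 z.2 + ψ z.1 z.2⟫ =
      (∫ z : ℝ × E, ⟪G z.1 z.2 (X z.1 z.2), U z.1 z.2⟫) +
        (∫ z : ℝ × E, ⟪G z.1 z.2 (X z.1 z.2), ψ z.1 z.2⟫) +
        (∫ z : ℝ × E, ⟪fderiv ℝ (ψ z.1) z.2 (X z.1 z.2), U z.1 z.2⟫) +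
        ∫ z : ℝ × E, ⟪fderiv ℝ (ψ z.1) z.2 (X z.1 z.2), ψ z.1 z.2⟫ := by
    have iab : Integrable (fun z : ℝ × E => ⟪G z.1 z.2 (X z.1 z.2), U z.1 z.2⟫ +
        ⟪G z.1 z.2 (X z.1 z.2), ψ z.1 z.2⟫) volume := ia.add ib
    have iabc : Integrable (fun z : ℝ × E => ⟪G z.1 z.2 (X z.1 z.2), U z.1 z.2⟫ +
        ⟪G z.1 z.2 (X z.1 z.2), ψ z.1 z.2⟫ + ⟪fderiv ℝ (ψ z.1) z.2 (X z.1 z.2), U z.1 z.2⟫) volume := iab.add ic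
    rw [← integral_add ia ib, ← integral_add iab ic, ← integral_add iabc id']
    refine integral_congr_ae (ae_of_all _ fun z => ?_)
    simp only [FunLike.coe_add, Pi.add_apply, inner_add_left, inner_add_right]
    ring
  have eR : ∫ z : ℝ × E, ‖U z.1 z.2 + ψ z.1 z.2‖ ^ 2 * VectorCalculus.divergence (X z.1) z.2 =
      (∫ z : ℝ × E, ‖U z.1 z.2‖ ^ 2 * VectorCalculus.divergence (X z.1) z.2) +
        2 * (∫ z : ℝ × E, ⟪U z.1 z.2, ψ z.1 z.2⟫ * VectorCalculus.divergence (X z.1) z.2) +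
        ∫ z : ℝ × E, ‖ψ z.1 z.2‖ ^ 2 * VectorCalculus.divergence (X z.1) z.2 := by
    have if2 : Integrable (fun z : ℝ × E =>
        2 * (⟪U z.1 z.2, ψ z.1 z.2⟫ * VectorCalculus.divergence (X z.1) z.2)) volume := if'.const_mul 2
    have ief : Integrable (fun z : ℝ × E => ‖U z.1 z.2‖ ^ 2 * VectorCalculus.divergence (X z.1) z.2 +
        2 * (⟪U z.1 z.2, ψ z.1 z.2⟫ * VectorCalculus.divergence (X z.1) z.2)) volume := ie.add if2
    rw [← integral_const_mul, ← integral_add ie if2, ← integral_add ief ig]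
    refine integral_congr_ae (ae_of_all _ fun z => ?_)
    dsimp only
    rw [norm_add_sq_real]
    ring
  rw [eL, eR] at T1
  linarith

end Polarization

end Literature.Analysis.FluidPDE

end
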